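import Summits.BirchSwinnertonDyer.BirchSwinnertonDyer.Theorems.ErratumRoadFiveEulerHalfJetchevAtPDefect
import Summits.BirchSwinnertonDyer.BirchSwinnertonDyer.Theses.ErratumRoadFive
import HarnessLib

/-!
# Route `ErratumRoadFive`, crux `EulerHalfNotRamNoInertSetAtFive` (item stmt-BirchSwinnertonDyer-19715) — ROAD J for the line's piece S1b
# `stub_res_pOnlyMultCarrierAtFive` (the exceptional-zero core: `p` the only multiplicative prime; 334 ∕ 334 R1a census pairs): the registered stub
# VERBATIM (and v1's S1) from `PublishedInputsFive` + `X11aLowerHalf` + ONE displayed binder — Jetchev's `K`-bound at the pair's own prime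

Cell `bsd-stepL`, seat `bsd-line-er5-p1-w2` (D-0154 width seat -w2 on crux 19715; lead `bsd-line-er5-p1` g0: «GO on road J for S1b», 06:31Z),
`--supports stmt-BirchSwinnertonDyer-19715` (helper: the stub is proved MODULO the displayed binder, not closed). THEOREMS ONLY; by-name instantiation of
`Theorems/ErratumRoadFiveEulerHalfJetchevAtPDefect.lean` (same seat; mechanism, the binder's text and its beyond-print status there).

THE THREE TYPED SUPPLIERS OF S1b after this file (the planner ∕ lead pick; none is print): (J) this road — `hJ` = Jetchev 2008 Cor. 1.5's inequality in
its `K`-form with `q := p ∥ N` (print: `p ∤ N`), no `p`-adic height, no exceptional display, no Shimura curve; (RELT+Sch) mult-p4 g2's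
`ExceptionalZeroRoad.stub_res_pOnlyMultAtFive_of_relativeLeadingTerm_of_regulatorNonvanishing` — the exact exceptional leading constant (beyond print
without a second semistable prime) + one Schneider row per pair; (UB) bdp g19's `EulerHalfUB.stub_res_pOnlyMultAtFive_of_ubB_of_items` — the Λ^ur-integral
BDP upper bound UB∃♭ᴮ (not in print).

* `stub_res_pOnlyMultCarrierAtFive_of_jetchevAtP_of_items` — S1b of the registered line v2b′ (plan g39 06:16Z, 57dff3461297db82) VERBATIM as conclusion,
  hypotheses `PublishedInputsFive` (used: Gross–Zagier, Kolyvagin, GZK, modularity ×2, Friedberg–Hoffstein split form, Mazur 1978), `X11aLowerHalf` (the twists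
  are X11a pairs: `X11b.classX11a_twist_of_not_ram`), `hJ`. The stub's binders «p split», «p ∣ ord_pΔ_min», `p ∣ ∏c` are not used.
* `stub_res_pOnlyMultAtFive_of_jetchevAtP_of_items` — v1's S1 (plan g26) likewise.

HONEST FRAMING: CONDITIONAL on `hJ` — NOT IN PRINT at `p ∣ N` (Jetchev's Hypothesis (∗) has `p ∤ N`; at a split multiplicative `p` with `p ∣ c_p` the
local group `E(ℚ_p)` may carry `p`-torsion from the component group — Castella erratum (iv) ∕ Skinner–Zhang (b) territory —, which is what the missing
local step at `v ∣ p` must control) — and on the OPEN crux `X11aLowerHalf`; nothing is booked; no census label moves (T7); neither S1b nor crux 19715 is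
closed; BSD is proved for no curve; no summit statement is touched.
-/

noncomputable section

open scoped Classical NumberField

open WeierstrassCurve NumberField IsDedekindDomain
  Literature.NumberTheory.EllipticCurves
  Literature.NumberTheory.EllipticCurves.ModularForms
  Literature.NumberTheory.EllipticCurves.Rank1Residual
  Literature.NumberTheory.EllipticCurves.Rank1Residual.Typed
  Literature.NumberTheory.Automorphic
  Summit.BirchSwinnertonDyer.Rank1Residual Summit.BirchSwinnertonDyer.Rank1Residual.X11b
  Summit.BirchSwinnertonDyer.BirchSwinnertonDyer.Theses.ErratumRoadFive

-- the cell's Theorems namespace repeats the summit name (Summit.<Summit>.<Problem>), as in every sibling file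
set_option linter.dupNamespace false

namespace Summit.BirchSwinnertonDyer.BirchSwinnertonDyer.Theorems.JetchevAtP

/-- **Registered stub S1b `stub_res_pOnlyMultCarrierAtFive` of crux 19715's line (v2b′) — VERBATIM as conclusion — ON ROAD J**: from
`PublishedInputsFive`, `X11aLowerHalf` and the displayed binder `hJ` (Jetchev's `K`-bound with the Tamagawa term at `q := p`; NOT in print at `p ∣ N`).
One line over `missingUpperBoundAt_of_onlyMult_of_lowerTwists_of_jetchevAtP`, the twists' lower halves from `X11aLowerHalf` through
`X11b.classX11a_twist_of_not_ram`. CONDITIONAL; helper, no stub credit; nothing booked.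
[cite: Jetchev2008, Cor. 1.5 (arXiv p. 3) — printed under Hyp. (*) p ∤ N; taken here at q := p ∥ N: NOT in print]
[cite: Miller2011LMS, Thm. 5.4 (p. 11) and Def. 1.1] [cite: McCallumLMS1991, §1 Theorem (Kolyvagin), p. 296] -/
theorem stub_res_pOnlyMultCarrierAtFive_of_jetchevAtP_of_items (h₅ : PublishedInputsFive) (h₃ : X11aLowerHalf)
    -- the DISPLAYED binder: Jetchev's `K`-bound with the Tamagawa term at `q := p ∣ N` (NOT in print at `p ∣ N`; module docstring)
    (hJ : ∀ (N : ℕ) [NeZero N] (W : WeierstrassCurve ℚ) (K : Type) [Field K] [NumberField K] [W.IsElliptic],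
      IsImaginaryQuadratic K → SatisfiesHeegnerHypothesis N K →
      ∀ {P : (W.baseChange K).toAffine.Point}, IsHeegnerPoint N W K P → ¬ IsOfFinAddOrder P →
      ∀ {p : ℕ} [Fact p.Prime], p ≠ 2 → W.HasSurjectiveModNGaloisRep p → p ∣ N →
        padicValNat p (Nat.card (W.baseChange K).sha) +
            2 * padicValNat p ((W.baseChange ℚ_[p]).localTamagawaNumber ℤ_[p]) ≤
          2 * padicValNat p (AddSubgroup.zmultiples P).index)
    :
    ∀ (W : WeierstrassCurve ℚ) [W.IsElliptic] [W.IsGloballyMinimal] (p : ℕ) [Fact p.Prime], Summit.BirchSwinnertonDyer.Rank1Residual.ClassX11b W p → 5 ≤ p → Literature.NumberTheory.EllipticCurves.Rank1Residual.Surj W p → ¬ Literature.NumberTheory.EllipticCurves.Rank1Residual.Ram W p → p ∣ W.tamagawaProduct → (∀ (ℓ : ℕ) [Fact ℓ.Prime], W.HasMultiplicativeReductionAtPrime ℓ → ℓ = p) → W.HasSplitMultiplicativeReductionAtPrime p → p ∣ padicValInt p W.minimalDiscriminantInt → Literature.NumberTheory.EllipticCurves.Rank1Residual.Typed.MissingUpperBoundAt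 W p := by
  obtain ⟨hGZ, hKo, -, -, -, hGZK, hmod, hnf, -, hFHs, hMaz, -, -, -, -⟩ := h₅
  intro W _ _ p _ hX hp5 hsurj hnram _ honly _ _
  exact missingUpperBoundAt_of_onlyMult_of_lowerTwists_of_jetchevAtP hGZ hKo hGZK hmod hnf hFHs hMaz hJ W p hX.2.2.1 hX.2.2.2
    hsurj hp5 hX.1 honly
    (fun K _ _ Wd _ _ hK hHN _ hC hrd ↦ by
      obtain ⟨C, hC⟩ := hC
      exact h₃ Wd p (X11b.classX11a_twist_of_not_ram W p hX hnram K hK hHN C hC hrd))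

/-- **v1's registered stub S1 `stub_res_pOnlyMultAtFive` (plan g26) — VERBATIM as conclusion — ON ROAD J**, same inputs (its locus contains S1b's; the
road does not need «p split» or «p ∣ ord_pΔ_min»). CONDITIONAL; helper; nothing booked.
[cite: Jetchev2008, Cor. 1.5 (arXiv p. 3) — printed under Hyp. (*) p ∤ N; taken here at q := p ∥ N: NOT in print] [cite: Miller2011LMS, Def. 1.1] -/
theorem stub_res_pOnlyMultAtFive_of_jetchevAtP_of_items (h₅ : PublishedInputsFive) (h₃ : X11aLowerHalf)
    -- the DISPLAYED binder: Jetchev's `K`-bound with the Tamagawa term at `q := p ∣ N` (NOT in print at `p ∣ N`; module docstring)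
    (hJ : ∀ (N : ℕ) [NeZero N] (W : WeierstrassCurve ℚ) (K : Type) [Field K] [NumberField K] [W.IsElliptic],
      IsImaginaryQuadratic K → SatisfiesHeegnerHypothesis N K →
      ∀ {P : (W.baseChange K).toAffine.Point}, IsHeegnerPoint N W K P → ¬ IsOfFinAddOrder P →
      ∀ {p : ℕ} [Fact p.Prime], p ≠ 2 → W.HasSurjectiveModNGaloisRep p → p ∣ N →
        padicValNat p (Nat.card (W.baseChange K).sha) +
            2 * padicValNat p ((W.baseChange ℚ_[p]).localTamagawaNumber ℤ_[p]) ≤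
          2 * padicValNat p (AddSubgroup.zmultiples P).index)
    :
    ∀ (W : WeierstrassCurve ℚ) [W.IsElliptic] [W.IsGloballyMinimal] (p : ℕ) [Fact p.Prime], Summit.BirchSwinnertonDyer.Rank1Residual.ClassX11b W p → 5 ≤ p → Literature.NumberTheory.EllipticCurves.Rank1Residual.Surj W p → ¬ Literature.NumberTheory.EllipticCurves.Rank1Residual.Ram W p → p ∣ W.tamagawaProduct → (∀ (ℓ : ℕ) [Fact ℓ.Prime], W.HasMultiplicativeReductionAtPrime ℓ → ℓ = p) → Literature.NumberTheory.EllipticCurves.Rank1Residual.Typed.MissingUpperBoundAt W p := by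
  obtain ⟨hGZ, hKo, -, -, -, hGZK, hmod, hnf, -, hFHs, hMaz, -, -, -, -⟩ := h₅
  intro W _ _ p _ hX hp5 hsurj hnram _ honly
  exact missingUpperBoundAt_of_onlyMult_of_lowerTwists_of_jetchevAtP hGZ hKo hGZK hmod hnf hFHs hMaz hJ W p hX.2.2.1 hX.2.2.2
    hsurj hp5 hX.1 honly
    (fun K _ _ Wd _ _ hK hHN _ hC hrd ↦ by
      obtain ⟨C, hC⟩ := hC
      exact h₃ Wd p (X11b.classX11a_twist_of_not_ram W p hX hnram K hK hHN C hC hrd))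


/-! ### (appended) The line's plan-only rung `stub_rung_res_605a1` on road J -/

/-- **Registered plan-only rung `stub_rung_res_605a1` of crux 19715's line (v2b′; S1b at the smallest R1a pair (605a1, 5) =
`[1,−1,0,−1414,−44027]`, `N = 605 = 5·11²`, `Δ_min = −5⁵·11⁸`) — VERBATIM as conclusion — ON ROAD J**: the specialisation of
`stub_res_pOnlyMultCarrierAtFive_of_jetchevAtP_of_items` at the curve and `p = 5` (every binder of the rung is a binder of S1b at that pair).
CONDITIONAL on `PublishedInputsFive`, `X11aLowerHalf` and the displayed `hJ` (NOT in print at `p ∣ N`); helper, no stub credit (the registered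
rung has no item binders); nothing booked; BSD(605a1, 5) is NOT proved by this.
[cite: Cremona1997, Table 1 (curve 605a1)] [cite: Jetchev2008, Cor. 1.5 (arXiv p. 3) — printed under Hyp. (*) p ∤ N; taken here at q := p ∥ N: NOT in print] -/
theorem stub_rung_res_605a1_of_jetchevAtP_of_items (h₅ : PublishedInputsFive) (h₃ : X11aLowerHalf)
    (hJ : ∀ (N : ℕ) [NeZero N] (W : WeierstrassCurve ℚ) (K : Type) [Field K] [NumberField K] [W.IsElliptic],
      IsImaginaryQuadratic K → SatisfiesHeegnerHypothesis N K →
      ∀ {P : (W.baseChange K).toAffine.Point}, IsHeegnerPoint N W K P → ¬ IsOfFinAddOrder P →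
      ∀ {p : ℕ} [Fact p.Prime], p ≠ 2 → W.HasSurjectiveModNGaloisRep p → p ∣ N →
        padicValNat p (Nat.card (W.baseChange K).sha) +
            2 * padicValNat p ((W.baseChange ℚ_[p]).localTamagawaNumber ℤ_[p]) ≤
          2 * padicValNat p (AddSubgroup.zmultiples P).index)
    [((⟨1, -1, 0, -1414, -44027⟩ : WeierstrassCurve ℤ).baseChange ℚ).IsElliptic] [((⟨1, -1, 0, -1414, -44027⟩ : WeierstrassCurve ℤ).baseChange ℚ).IsGloballyMinimal] [Fact (Nat.Prime 5)] : Summit.BirchSwinnertonDyer.Rank1Residual.ClassX11b ((⟨1, -1, 0, -1414, -44027⟩ : WeierstrassCurve ℤ).baseChange ℚ) 5 → 5 ≤ 5 → Literature.NumberTheory.EllipticCurves.Rank1Residual.Surj ((⟨1, -1, 0, -1414, -44027⟩ : WeierstrassCurve ℤ).baseChange ℚ) 5 → ¬ Literature.NumberTheory.EllipticCurves.Rank1Residual.Ram ((⟨1, -1, 0, -1414, -44027⟩ : WeierstrassCurve ℤ).baseChange ℚ) 5 → 5 ∣ ((⟨1, -1, 0, -1414, -44027⟩ : WeierstrassCurve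 ℤ).baseChange ℚ).tamagawaProduct → (∀ (ℓ : ℕ) [Fact ℓ.Prime], ((⟨1, -1, 0, -1414, -44027⟩ : WeierstrassCurve ℤ).baseChange ℚ).HasMultiplicativeReductionAtPrime ℓ → ℓ = 5) → ((⟨1, -1, 0, -1414, -44027⟩ : WeierstrassCurve ℤ).baseChange ℚ).HasSplitMultiplicativeReductionAtPrime 5 → 5 ∣ padicValInt 5 ((⟨1, -1, 0, -1414, -44027⟩ : WeierstrassCurve ℤ).baseChange ℚ).minimalDiscriminantInt → Literature.NumberTheory.EllipticCurves.Rank1Residual.Typed.MissingUpperBoundAt ((⟨1, -1, 0, -1414, -44027⟩ : WeierstrassCurve ℤ).baseChange ℚ) 5 :=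
  stub_res_pOnlyMultCarrierAtFive_of_jetchevAtP_of_items h₅ h₃ hJ _ 5

end Summit.BirchSwinnertonDyer.BirchSwinnertonDyer.Theorems.JetchevAtP

end
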